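import Mathlib

/-!
# The lattice points of the scaled standard simplex form a mediated set

[cite: IlimanDewolff2016GP, Definition 4 («Let P̂ = {0, α(1), …, α(n)} ⊂ (2ℕ)ⁿ be such that
conv(P̂) is a simplex and let L ⊆ conv(P̂) ∩ ℕⁿ. … Ā(L) = {½(s + t) ∈ ℕⁿ : s, t ∈ L ∩ (2ℕ)ⁿ,
s ≠ t} … We say that L is P̂-mediated, if P̂ ⊆ L ⊆ Ā(L) ∪ P̂, i.e., if every β ∈ L ∖ P̂ is a
midpoint of two distinct even points in L»), Example 6 («The scaled standard simplex given by
conv{0, 2d·e_1, …, 2d·e_n} ⊂ ℝⁿ for d ∈ ℕ is an H-simplex»), Theorem 5 (Reznick: the maximal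
P̂-mediated set P* contains every P̂-mediated set)]
[cite: Reznick1989, §2 (frameworks and mediated sets; the simplex with vertices 2d·e_i), as
quoted in IlimanDewolff2016GP §2]

For `P̂ = {0, 2d e_1, …, 2d e_n}` the full set of lattice points
`L = conv(P̂) ∩ ℕⁿ = {β ∈ ℕⁿ : |β| ≤ 2d}` is `P̂`-mediated: every `β ∈ L` which is not a vertex is
the midpoint of two DISTINCT even lattice points `s, t ∈ L ∩ (2ℕ)ⁿ` (`stdSimplex_mediated`).
Since the maximal `P̂`-mediated set contains every `P̂`-mediated set (Theorem 5), it is all of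
`L` — the scaled standard simplex is an `H`-simplex (Example 6); by Theorem 7 of the source every
nonnegative circuit polynomial supported on it is then a sum of binomial squares.  Only the
combinatorial statement is formalised here.

Construction.  Write `s = 2p`, `t = 2(β − p)` with `p ≤ β` coordinatewise: the constraints are
`|β| − d ≤ |p| ≤ d` and `2p ≠ β`.  If `|β| < 2d` two admissible values of `|p|` exist and one of
them has `2|p| ≠ |β|`; if `|β| = 2d` and some `β_i` is odd any `p` with `|p| = d` works; if
`|β| = 2d` with `β` even and not a vertex, `β` has two nonzero (hence `≥ 2`) coordinates `i ≠ k`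
and `s = β + 2e_i − 2e_k`, `t = β − 2e_i + 2e_k` do.

A contrasting printed example: the Newton simplex `Δ = conv{(0,0),(4,2),(2,4)}` of the Motzkin
polynomial is NOT an `H`-simplex [cite: IlimanDewolff2016, §5.1 («a lattice simplex Δ [is] an
H-simplex, meaning, that all lattice points in Δ except the vertices are midpoints of two even
distinct lattice points in Δ»), Example 38 («The Newton polytope of the Motzkin polynomial
m = 1 + x⁴y² + x²y⁴ − 3x²y² ∈ P_{2,6} ∖ Σ_{2,6} is an M-simplex Δ = conv{(0,0),(4,2),(2,4)}»)]:
its even interior point `(2,2)` is the midpoint of two even lattice points of `Δ` only trivially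
(`motzkinSimplex_midpoint_rigid`; the lattice points of `Δ` are described by the three facet
inequalities `v ≤ 2u`, `u ≤ 2v`, `u + v ≤ 6`).

All statements are fully proved; no named facts are introduced.
-/

namespace Literature.Algebra.Polynomial.StandardSimplexMediated

open Finset

variable {n : Type*} [Fintype n] [DecidableEq n]

/-- A sub-vector with prescribed coordinate sum («greedy fill»). [folklore] -/
private theorem exists_le_sum_eq (β : n → ℕ) :
    ∀ m, m ≤ ∑ i, β i → ∃ p : n → ℕ, (∀ i, p i ≤ β i) ∧ ∑ i, p i = m := by
  intro m
  induction m with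
  | zero => exact fun _ => ⟨0, fun i => Nat.zero_le _, by simp⟩
  | succ m ih =>
    intro hm
    obtain ⟨p, hp, hsum⟩ := ih (Nat.le_of_succ_le hm)
    have hex : ∃ i, p i < β i := by
      by_contra h
      push Not at h
      have : ∑ i, β i ≤ ∑ i, p i := sum_le_sum fun i _ => h i
      omega
    obtain ⟨i, hi⟩ := hex
    refine ⟨p + Pi.single i 1, fun j => ?_, ?_⟩
    · rcases eq_or_ne j i with rfl | hj
      · simp only [Pi.add_apply, Pi.single_eq_same]
        omega
      · simp only [Pi.add_apply, Pi.single_eq_of_ne hj, add_zero]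
        exact hp j
    · simp only [Pi.add_apply]
      rw [sum_add_distrib, hsum, Fintype.sum_pi_single']

omit [DecidableEq n] in
/-- From a sub-vector `p ≤ β` with `|β| − d ≤ |p| ≤ d` and `2p ≠ β`: the even points `s = 2p`,
`t = 2(β − p)` are distinct, lie in `2d Δ`, and `s + t = 2β`. [folklore] -/
private theorem mediated_of_sub {d : ℕ} {β p : n → ℕ} (hle : ∀ i, p i ≤ β i)
    (h1 : ∑ i, p i ≤ d) (h2 : ∑ i, β i ≤ ∑ i, p i + d) (hne : 2 • p ≠ β) :
    ∃ s t : n → ℕ, s ≠ t ∧ (∀ i, Even (s i)) ∧ (∀ i, Even (t i)) ∧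
      ∑ i, s i ≤ 2 * d ∧ ∑ i, t i ≤ 2 * d ∧ s + t = 2 • β := by
  have hsub : ∑ i, (β i - p i) = ∑ i, β i - ∑ i, p i :=
    sum_tsub_distrib univ fun i _ => hle i
  refine ⟨2 • p, 2 • (β - p), ?_, fun i => ⟨p i, ?_⟩, fun i => ⟨β i - p i, ?_⟩, ?_, ?_, ?_⟩
  · intro h
    apply hne
    funext i
    have hi := congrFun h i
    have hle' := hle i
    simp only [Pi.smul_apply, smul_eq_mul, Pi.sub_apply] at hi
    simp only [Pi.smul_apply, smul_eq_mul]
    omega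
  · simp only [Pi.smul_apply, smul_eq_mul]; ring
  · simp only [Pi.smul_apply, Pi.sub_apply, smul_eq_mul]; ring
  · simp only [Pi.smul_apply, smul_eq_mul, ← mul_sum]
    omega
  · simp only [Pi.smul_apply, Pi.sub_apply, smul_eq_mul, ← mul_sum]
    rw [hsub]
    omega
  · funext i
    have hle' := hle i
    simp only [Pi.add_apply, Pi.smul_apply, Pi.sub_apply, smul_eq_mul]
    omega

/-- Changing two coordinates changes the sum accordingly. [folklore] -/
private theorem sum_eq_of_two {f g : n → ℕ} {i k : n} (hki : k ≠ i)
    (hfg : ∀ j, j ≠ i → j ≠ k → f j = g j) (h : f i + f k = g i + g k) :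
    ∑ j, f j = ∑ j, g j := by
  have hk : k ∈ univ.erase i := mem_erase.mpr ⟨hki, mem_univ k⟩
  have e1 : ∑ j, f j = f i + (f k + ∑ j ∈ (univ.erase i).erase k, f j) := by
    rw [add_sum_erase _ _ hk, add_sum_erase _ _ (mem_univ i)]
  have e2 : ∑ j, g j = g i + (g k + ∑ j ∈ (univ.erase i).erase k, g j) := by
    rw [add_sum_erase _ _ hk, add_sum_erase _ _ (mem_univ i)]
  have e3 : ∑ j ∈ (univ.erase i).erase k, f j = ∑ j ∈ (univ.erase i).erase k, g j :=
    sum_congr rfl fun j hj => hfg j (ne_of_mem_erase (mem_of_mem_erase hj)) (ne_of_mem_erase hj)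
  rw [e1, e2, e3]
  omega

/-- **The scaled standard simplex is mediated** (hence an `H`-simplex).  Let `β ∈ ℕⁿ` with
`|β| ≤ 2d`, `β ≠ 0` and `β ≠ 2d e_i` for all `i`.  Then there are even lattice points
`s ≠ t` of `2d Δ = {γ ∈ ℕⁿ : |γ| ≤ 2d}` with `s + t = 2β`, i.e. `β ∈ Ā(L)` for
`L = 2dΔ ∩ ℕⁿ` in the notation of Definition 4.
[cite: IlimanDewolff2016GP, Example 6 («conv{0, 2d·e_1, …, 2d·e_n} … is an H-simplex») with
Definition 4] [cite: Reznick1989, §2 (quoted ibid.)] -/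
theorem stdSimplex_mediated {d : ℕ} {β : n → ℕ} (hβ : ∑ i, β i ≤ 2 * d) (h0 : β ≠ 0)
    (hv : ∀ i, β ≠ Pi.single i (2 * d)) :
    ∃ s t : n → ℕ, s ≠ t ∧ (∀ i, Even (s i)) ∧ (∀ i, Even (t i)) ∧
      ∑ i, s i ≤ 2 * d ∧ ∑ i, t i ≤ 2 * d ∧ s + t = 2 • β := by
  have hS0 : 0 < ∑ i, β i := by
    by_contra h
    push Not at h
    apply h0
    funext i
    have := (sum_eq_zero_iff_of_nonneg fun j _ => Nat.zero_le (β j)).mp (Nat.le_zero.mp h) i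
      (mem_univ i)
    simpa using this
  by_cases hlt : ∑ i, β i < 2 * d
  · -- |β| < 2d: choose |p| with 2|p| ≠ |β|
    obtain ⟨m, hmS, hmd, hSm, hne⟩ :
        ∃ m, m ≤ ∑ i, β i ∧ m ≤ d ∧ ∑ i, β i ≤ m + d ∧ 2 * m ≠ ∑ i, β i := by
      by_cases h2 : 2 * min d (∑ i, β i) = ∑ i, β i
      · refine ⟨min d (∑ i, β i) - 1, ?_, ?_, ?_, ?_⟩
        · exact le_trans (Nat.sub_le _ _) (min_le_right _ _)
        · exact le_trans (Nat.sub_le _ _) (min_le_left _ _)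
        · rcases le_total d (∑ i, β i) with h | h
          · rw [min_eq_left h] at h2 ⊢; omega
          · rw [min_eq_right h] at h2 ⊢; omega
        · rcases le_total d (∑ i, β i) with h | h
          · rw [min_eq_left h] at h2 ⊢; omega
          · rw [min_eq_right h] at h2 ⊢; omega
      · refine ⟨min d (∑ i, β i), min_le_right _ _, min_le_left _ _, ?_, h2⟩
        rcases le_total d (∑ i, β i) with h | h
        · rw [min_eq_left h]; omega
        · rw [min_eq_right h]; omega
    obtain ⟨p, hp, hsum⟩ := exists_le_sum_eq β m hmS
    refine mediated_of_sub hp (hsum ▸ hmd) (by omega) ?_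
    intro h
    apply hne
    have hs := congrArg (fun f : n → ℕ => ∑ i, f i) h
    simp only [Pi.smul_apply, smul_eq_mul, ← mul_sum] at hs
    omega
  · -- |β| = 2d
    have hS : ∑ i, β i = 2 * d := le_antisymm hβ (not_lt.mp hlt)
    by_cases hodd : ∃ i, Odd (β i)
    · obtain ⟨i, hi⟩ := hodd
      obtain ⟨p, hp, hsum⟩ := exists_le_sum_eq β d (by omega)
      refine mediated_of_sub hp hsum.le (by omega) ?_
      intro h
      have h' := congrFun h i
      simp only [Pi.smul_apply, smul_eq_mul] at h'
      exact (Nat.not_even_iff_odd.mpr hi) ⟨p i, by omega⟩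
    · push Not at hodd
      have hev : ∀ i, Even (β i) := fun i => Nat.not_odd_iff_even.mp (hodd i)
      -- two nonzero coordinates
      obtain ⟨i, hi⟩ : ∃ i, β i ≠ 0 := by
        by_contra h
        push Not at h
        exact h0 (funext h)
      obtain ⟨k, hki, hk⟩ : ∃ k, k ≠ i ∧ β k ≠ 0 := by
        by_contra h
        push Not at h
        apply hv i
        funext j
        rcases eq_or_ne j i with rfl | hj
        · rw [Pi.single_eq_same, ← hS, ← add_sum_erase _ β (mem_univ j),
            sum_eq_zero fun l hl => h l (ne_of_mem_erase hl), add_zero]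
        · rw [Pi.single_eq_of_ne hj]
          exact h j hj
      have hi2 : 2 ≤ β i := by obtain ⟨r, hr⟩ := hev i; omega
      have hk2 : 2 ≤ β k := by obtain ⟨r, hr⟩ := hev k; omega
      refine ⟨fun j => if j = i then β i + 2 else if j = k then β k - 2 else β j,
        fun j => if j = i then β i - 2 else if j = k then β k + 2 else β j,
        ?_, ?_, ?_, ?_, ?_, ?_⟩
      · intro h
        have h' := congrFun h i
        simp only [if_true] at h'
        omega
      · intro j
        simp only
        split_ifs with h1 h2
        · obtain ⟨r, hr⟩ := hev i; exact ⟨r + 1, by omega⟩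
        · obtain ⟨r, hr⟩ := hev k; exact ⟨r - 1, by omega⟩
        · exact hev j
      · intro j
        simp only
        split_ifs with h1 h2
        · obtain ⟨r, hr⟩ := hev i; exact ⟨r - 1, by omega⟩
        · obtain ⟨r, hr⟩ := hev k; exact ⟨r + 1, by omega⟩
        · exact hev j
      · rw [← hS]
        refine le_of_eq (sum_eq_of_two hki (fun j hj hk' => by simp [hj, hk']) ?_)
        simp only [if_true, if_neg hki]
        omega
      · rw [← hS]
        refine le_of_eq (sum_eq_of_two hki (fun j hj hk' => by simp [hj, hk']) ?_)
        simp only [if_true, if_neg hki]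
        omega
      · funext j
        simp only [Pi.add_apply, Pi.smul_apply, smul_eq_mul]
        split_ifs with h1 h2
        · subst h1; omega
        · subst h2; omega
        · omega

/-- The one-dimensional case spelled out: for `0 < β < 2d` the midpoint representation is
`2β = (β − 1) + (β + 1)` (`β` odd) or `(β − 2) + (β + 2)` (`β` even). [cite: IlimanDewolff2016GP,
Example 6 (n = 1)] -/
theorem interval_mediated {d β : ℕ} (h0 : 0 < β) (h1 : β < 2 * d) :
    ∃ s t : ℕ, s ≠ t ∧ Even s ∧ Even t ∧ s ≤ 2 * d ∧ t ≤ 2 * d ∧ s + t = 2 * β := by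
  rcases Nat.even_or_odd β with ⟨r, hr⟩ | ⟨r, hr⟩
  · exact ⟨β - 2, β + 2, by omega, ⟨r - 1, by omega⟩, ⟨r + 1, by omega⟩, by omega, by omega,
      by omega⟩
  · exact ⟨β - 1, β + 1, by omega, ⟨r, by omega⟩, ⟨r + 1, by omega⟩, by omega, by omega,
      by omega⟩

/-- **The Motzkin simplex is not an `H`-simplex.**  The lattice points of
`Δ = conv{(0,0),(4,2),(2,4)}` are the `(u,v) ∈ ℕ²` with `v ≤ 2u`, `u ≤ 2v`, `u + v ≤ 6` (facet
description; barycentric coordinates `(2u − v)/6`, `(2v − u)/6`).  If two EVEN lattice points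
`(u₁,v₁)`, `(u₂,v₂)` of `Δ` have midpoint `(2,2)`, they coincide: the interior lattice point
`(2,2)` of the Motzkin polynomial's Newton polytope is not the midpoint of two distinct even
lattice points of `Δ`, so `Δ ∩ ℤ²` is not mediated (an `M`-simplex, in contrast with
`stdSimplex_mediated`).
[cite: IlimanDewolff2016, Example 38 («is an M-simplex Δ = conv{(0,0),(4,2),(2,4)}»), §5.1
(definition of H-simplex)] -/
theorem motzkinSimplex_midpoint_rigid (u₁ v₁ u₂ v₂ : ℕ)
    (he : Even u₁ ∧ Even v₁ ∧ Even u₂ ∧ Even v₂)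
    (h₁ : v₁ ≤ 2 * u₁ ∧ u₁ ≤ 2 * v₁ ∧ u₁ + v₁ ≤ 6)
    (h₂ : v₂ ≤ 2 * u₂ ∧ u₂ ≤ 2 * v₂ ∧ u₂ + v₂ ≤ 6)
    (hmid : u₁ + u₂ = 4 ∧ v₁ + v₂ = 4) : u₁ = u₂ ∧ v₁ = v₂ := by
  obtain ⟨⟨a, ha⟩, ⟨b, hb⟩, ⟨c, hc⟩, ⟨e, hee⟩⟩ := he
  omega

/-- The three vertices `(0,0)`, `(4,2)`, `(2,4)` of the Motzkin simplex satisfy the facet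
inequalities used in `motzkinSimplex_midpoint_rigid`, each facet being tight at two of them, and
the inner exponent `(2,2)` satisfies them strictly (sanity check of the facet description).
[cite: IlimanDewolff2016, Example 38] -/
theorem motzkinSimplex_facets :
    (∀ q ∈ ({(0, 0), (4, 2), (2, 4)} : Finset (ℕ × ℕ)),
      q.2 ≤ 2 * q.1 ∧ q.1 ≤ 2 * q.2 ∧ q.1 + q.2 ≤ 6) ∧
    (2 < 2 * 2 ∧ 2 + 2 < 6) := by
  decide

end Literature.Algebra.Polynomial.StandardSimplexMediated
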